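import Literature.NumberTheory.Automorphic.JacquetRayHeckeOperator   -- ★ p832205 (R1): `heckeRay`, `heckeRay_iterate_eq`, `mk_heckeRay(_iterate)`, `exists_heckeRay_iterate_eq_zero`
import Literature.NumberTheory.Automorphic.JacquetLemma             -- ★ `JacquetLemma.fixedPoints_jacquetModule_le_map` (Casselman Thm. 3.3.3)
import HarnessLib

/-!
# The Hecke ray operator on `V^K`, II: `ker(V^K → V_N)` = the `T_a`-nilpotent part, `[V^K] = V_N^{K ∩ M}`, the Fitting decomposition
# `V^K = ker T_a^N ⊕ im T_a^N`, and the lift of Jacquet-module eigenvectors to `T_a`-eigenvectors (Casselman 1995, §4.1; rank-one kit R2)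

Topic `NumberTheory/Automorphic`; namespace `Representation` (sequel of ★ `JacquetRayHeckeOperator`).  THEOREMS + TWO DEFINITIONS WITH BODY
(`Representation.heckeRayEnd` = `T_a` as a `Module.End k (ρ.fixedPoints K)`; `Representation.fixedPointsMk` = the class map `V^K → V_N`); no named
fact, no instance, no `sorry`.  Cell `hodgecm-mathlib`, F0∕P3, seat F0P3-p01 (g10): file (R2) of the rank-one road to Casselman's
square-integrability criterion ★ `UnitaryGroup.U3SquareIntegrableExponents` [Casselman1995, Thm. 4.4.6].

SETTING as in R1: `ρ` smooth (resp. admissible) on a `k`-space, `char k = 0`; `t = (P, M, N)` with `N` closed; `K` compact open with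
`K = (K ∩ N̄)(K ∩ M)(K ∩ N)`; `a ∈ M` dominant (`a (K ∩ N) a⁻¹ ⊆ K`, `a⁻¹ (K ∩ N̄) a ⊆ K ∩ N̄`, `[a, K ∩ M] = 1`) with `⋃ₘ a⁻ᵐ (K ∩ N) aᵐ = N`.

RESULTS.
* §2 `fixedPointsMk_eq_zero_iff` — **`[v] = 0 ⇔ ∃ m, T_a^m v = 0`** on `V^K` [Casselman1995, Prop. 4.1.4 + 4.1.6; BernsteinZelevinsky1976, 3.17–3.19];
  `fixedPointsMk_ne_zero_of_eigenvector` — a `T_a`-eigenvector with non-zero eigenvalue `c` has `[v] ≠ 0` and `π_N(a)[v] = c[v]`.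
* §3 `range_fixedPointsMk_eq` — **`[V^K] = V_N^{K ∩ M}`** for `K = K_n` of an `IwahoriDatum` and admissible `ρ` (★ Jacquet's lemma)
  [Casselman1995, Thm. 3.3.3].
* §4 `exists_fitting_index`, `fixedPointsMk_injOn_range_pow`, `map_fixedPointsMk_range_pow_eq` — for admissible `ρ` there is `N` with
  `V^K = ker T_a^N ⊕ im T_a^N`, `[·]` injective on `im T_a^N` and `[im T_a^N] = [V^K]`; hence
  **`exists_heckeRayEnd_eigenvector_of_jacquet`: every eigenvector `w ∈ [V^K]` of `π_N(a)` (eigenvalue `c`) lifts to `v ∈ V^K`, `v ≠ 0`,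
  `T_a v = c v`, `[v] = w`** [Casselman1995, Prop. 4.1.6; BernsteinZelevinsky1976, 3.19] — the link «exponents of `r_B(π)` at `a` ↔ non-zero
  spectrum of `T_a` on `V^K`» used by Casselman's criterion.

## References
* [Casselman1995] W. Casselman, *Introduction to the theory of admissible representations of `p`-adic reductive groups* (draft 1 May 1995),
  Thm. 3.3.3, §4.1 (Prop. 4.1.4, Prop. 4.1.6), Thm. 4.4.6.
* [BernsteinZelevinsky1976] I. N. Bernstein, A. V. Zelevinsky, Russian Math. Surveys 31:3 (1976), §2.1, §3.15–3.19.
-/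

set_option autoImplicit false

open scoped BigOperators Pointwise
open Literature.NumberTheory.Automorphic

namespace Representation

section Fitting

variable {k G V : Type*} [Field k] [CharZero k] [Group G] [TopologicalSpace G] [IsTopologicalGroup G]
  [AddCommGroup V] [Module k V] {ρ : Representation k G V}

/-! ## §1 `T_a` as a linear endomorphism of `V^K`; the class map `V^K → V_N` -/

variable (ρ) in
/-- **The Hecke ray operator as a linear endomorphism of `V^K`** (`ρ` smooth, `K` compact): `v ↦ e_K (ρ a v)`.
[cite: Casselman1995, §4.1] [cite: BernsteinZelevinsky1976, §3.15] -/
noncomputable def heckeRayEnd {K : Subgroup G} (hK : IsCompact (K : Set G)) (hρ : ρ.IsSmooth) (a : G) :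
    Module.End k (ρ.fixedPoints K) where
  toFun v := ⟨ρ.heckeRay K a v, heckeRay_mem_fixedPoints hK hρ a v⟩
  map_add' v w := Subtype.ext (heckeRay_add hK hρ a v w)
  map_smul' c v := Subtype.ext (heckeRay_smul hK hρ a c v)

/-- Unfolding of `heckeRayEnd` on underlying vectors. [cite: Casselman1995, §4.1] -/
theorem heckeRayEnd_apply_coe {K : Subgroup G} (hK : IsCompact (K : Set G)) (hρ : ρ.IsSmooth) (a : G) (v : ρ.fixedPoints K) :
    ((ρ.heckeRayEnd hK hρ a v : ρ.fixedPoints K) : V) = ρ.heckeRay K a v := rfl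

/-- Powers of `heckeRayEnd` are the iterates of `heckeRay` on underlying vectors. [cite: Casselman1995, §4.1] -/
theorem heckeRayEnd_pow_apply_coe {K : Subgroup G} (hK : IsCompact (K : Set G)) (hρ : ρ.IsSmooth) (a : G) (m : ℕ)
    (v : ρ.fixedPoints K) : ((((ρ.heckeRayEnd hK hρ a) ^ m) v : ρ.fixedPoints K) : V) = (ρ.heckeRay K a)^[m] v := by
  induction m with
  | zero => rfl
  | succ m ih => rw [pow_succ', Module.End.mul_apply, heckeRayEnd_apply_coe, ih, Function.iterate_succ_apply']

variable (ρ) in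
/-- **The class map `V^K → V_N`**, `v ↦ [v]` (★ `Coinvariants.mk` restricted to `V^K`). [cite: Casselman1995, Thm. 3.3.3] -/
noncomputable def fixedPointsMk (t : ParabolicTriple G) (K : Subgroup G) : ρ.fixedPoints K →ₗ[k] (t.restrict ρ).Coinvariants :=
  (Coinvariants.mk (t.restrict ρ)).comp (ρ.fixedPoints K).subtype

omit [CharZero k] [TopologicalSpace G] [IsTopologicalGroup G] in
/-- Unfolding of `fixedPointsMk`. [cite: Casselman1995, Thm. 3.3.3] -/
theorem fixedPointsMk_apply (t : ParabolicTriple G) (K : Subgroup G) (v : ρ.fixedPoints K) :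
    ρ.fixedPointsMk t K v = Coinvariants.mk (t.restrict ρ) (v : V) := rfl

omit [CharZero k] [TopologicalSpace G] [IsTopologicalGroup G] in
/-- The image of `V^K → V_N` is `[V^K]`. [cite: Casselman1995, Thm. 3.3.3] -/
theorem range_fixedPointsMk (t : ParabolicTriple G) (K : Subgroup G) :
    LinearMap.range (ρ.fixedPointsMk t K) = (ρ.fixedPoints K).map (Coinvariants.mk (t.restrict ρ)) := by
  rw [fixedPointsMk, LinearMap.range_comp, Submodule.range_subtype]

omit [CharZero k] [TopologicalSpace G] [IsTopologicalGroup G] in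
/-- A group element acts injectively on the Jacquet module: `π_N(g) x = 0 ⇒ x = 0`. [folklore] -/
private theorem jacquetModule_apply_eq_zero (t : ParabolicTriple G) (g : ↥t.M) {x : (t.restrict ρ).Coinvariants}
    (h : ρ.jacquetModule t g x = 0) : x = 0 := by
  have h' : ρ.jacquetModule t g⁻¹ (ρ.jacquetModule t g x) = x := by
    rw [← Module.End.mul_apply, ← map_mul, inv_mul_cancel, map_one, Module.End.one_apply]
  rw [← h', h, map_zero]

/-! ## §2 The kernel of `V^K → V_N` is the `T_a`-nilpotent part -/

/-- **`[v] = 0 ⇔ T_a^m v = 0` for some `m`** (`v ∈ V^K`; `a ∈ M` dominant, `⋃ₘ a⁻ᵐ (K ∩ N) aᵐ = N`): `⇒` is the nilpotence ★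
`exists_heckeRay_iterate_eq_zero`, `⇐` is `[T_a^m v] = π_N(a^m)[v]` (★ `mk_heckeRay_iterate`) and the invertibility of `π_N(a^m)`.
[cite: Casselman1995, Prop. 4.1.4, Prop. 4.1.6] [cite: BernsteinZelevinsky1976, 3.17–3.19] -/
theorem fixedPointsMk_eq_zero_iff (t : ParabolicTriple G) {K Nbar : Subgroup G} (hK : IsCompact (K : Set G))
    (hKo : IsOpen (K : Set G)) (hN : IsClosed (t.N : Set G)) (hρ : ρ.IsSmooth)
    (hfac : (K : Set G) = ((K ⊓ Nbar : Subgroup G) : Set G) * ((K ⊓ t.M : Subgroup G) : Set G) * ((K ⊓ t.N : Subgroup G) : Set G))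
    {a : G} (haMem : a ∈ t.M) (haM : ∀ m ∈ K ⊓ t.M, m * a = a * m) (haN : ∀ n ∈ K ⊓ t.N, a * n * a⁻¹ ∈ K)
    (haNbar : ∀ nb ∈ K ⊓ Nbar, a⁻¹ * nb * a ∈ K ⊓ Nbar)
    (hexh : ∀ n ∈ t.N, ∃ m : ℕ, ∀ m', m ≤ m' → a ^ m' * n * (a ^ m')⁻¹ ∈ K) (v : ρ.fixedPoints K) :
    ρ.fixedPointsMk t K v = 0 ↔ ∃ m : ℕ, ((ρ.heckeRayEnd hK hρ a) ^ m) v = 0 := by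
  constructor
  · intro h0
    obtain ⟨m, hm⟩ := exists_heckeRay_iterate_eq_zero t hK hKo hN hρ hfac haM haN haNbar hexh v.2 h0
    exact ⟨m, Subtype.ext (by rw [heckeRayEnd_pow_apply_coe]; exact hm m le_rfl)⟩
  · rintro ⟨m, hm⟩
    have h1 : Coinvariants.mk (t.restrict ρ) ((ρ.heckeRay K a)^[m] (v : V)) = 0 := by
      rw [← heckeRayEnd_pow_apply_coe hK hρ a m v, hm]; exact map_zero _
    rw [mk_heckeRay_iterate t hK hKo hN hρ hfac haMem haM haN haNbar v.2 m] at h1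
    exact jacquetModule_apply_eq_zero t _ h1

/-- **Non-zero eigenvalues of `T_a` on `V^K` are eigenvalues of `π_N(a)` on `[V^K] ⊆ V_N`**: if `T_a v = λ v`, `v ≠ 0`, `λ ≠ 0`, then
`[v] ≠ 0` and `π_N(a)[v] = λ [v]`. [cite: Casselman1995, Prop. 4.1.4, Prop. 4.1.6] -/
theorem fixedPointsMk_ne_zero_of_eigenvector (t : ParabolicTriple G) {K Nbar : Subgroup G} (hK : IsCompact (K : Set G))
    (hKo : IsOpen (K : Set G)) (hN : IsClosed (t.N : Set G)) (hρ : ρ.IsSmooth)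
    (hfac : (K : Set G) = ((K ⊓ Nbar : Subgroup G) : Set G) * ((K ⊓ t.M : Subgroup G) : Set G) * ((K ⊓ t.N : Subgroup G) : Set G))
    {a : G} (haMem : a ∈ t.M) (haM : ∀ m ∈ K ⊓ t.M, m * a = a * m) (haN : ∀ n ∈ K ⊓ t.N, a * n * a⁻¹ ∈ K)
    (haNbar : ∀ nb ∈ K ⊓ Nbar, a⁻¹ * nb * a ∈ K ⊓ Nbar)
    (hexh : ∀ n ∈ t.N, ∃ m : ℕ, ∀ m', m ≤ m' → a ^ m' * n * (a ^ m')⁻¹ ∈ K)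
    {v : ρ.fixedPoints K} (hv : v ≠ 0) {c : k} (hc : c ≠ 0) (hT : ρ.heckeRayEnd hK hρ a v = c • v) :
    ρ.fixedPointsMk t K v ≠ 0 ∧
      ρ.jacquetModule t ⟨a, haMem⟩ (ρ.fixedPointsMk t K v) = c • ρ.fixedPointsMk t K v := by
  have hpow : ∀ m : ℕ, ((ρ.heckeRayEnd hK hρ a) ^ m) v = c ^ m • v := by
    intro m
    induction m with
    | zero => rw [pow_zero, pow_zero, Module.End.one_apply, one_smul]
    | succ m ih => rw [pow_succ', Module.End.mul_apply, ih, map_smul, hT, smul_smul, pow_succ]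
  refine ⟨fun h0 => hv ?_, ?_⟩
  · obtain ⟨m, hm⟩ := (fixedPointsMk_eq_zero_iff t hK hKo hN hρ hfac haMem haM haN haNbar hexh v).1 h0
    rw [hpow m] at hm
    exact (smul_eq_zero.1 hm).resolve_left (pow_ne_zero m hc)
  · rw [fixedPointsMk_apply, ← mk_heckeRay t hK hN hρ hfac haMem haM (fun nb hnb => (Subgroup.mem_inf.1 (haNbar nb hnb)).1) v.2,
      ← heckeRayEnd_apply_coe hK hρ a v, hT]
    rfl

/-! ## §3 The image of `V^K → V_N` is `V_N^{K ∩ M}` (Jacquet's lemma ★) -/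

omit [CharZero k] [TopologicalSpace G] [IsTopologicalGroup G] in
/-- `[V^K] ⊆ V_N^{K ∩ M}`. [cite: Casselman1995, Thm. 3.3.3] -/
theorem range_fixedPointsMk_le (t : ParabolicTriple G) (K : Subgroup G) :
    LinearMap.range (ρ.fixedPointsMk t K) ≤ (ρ.jacquetModule t).fixedPoints (K.comap t.M.subtype) := by
  rintro _ ⟨v, rfl⟩
  rw [mem_fixedPoints]
  intro m hm
  rw [fixedPointsMk_apply, jacquetModule_mk]
  exact congrArg _ ((ρ.mem_fixedPoints K (v : V)).1 v.2 _ (Subgroup.mem_comap.1 hm))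

/-- **`[V^K] = V_N^{K ∩ M}` for the subgroups `K = K_n` of an Iwahori datum and an admissible `ρ`** — Jacquet's lemma ★
`JacquetLemma.fixedPoints_jacquetModule_le_map` gives `⊇`. [cite: Casselman1995, Thm. 3.3.3] [cite: BernsteinZelevinsky1976, §3.16] -/
theorem range_fixedPointsMk_eq (t : ParabolicTriple G) (𝓘 : t.IwahoriDatum) (hρa : ρ.IsAdmissible) (n : ℕ) :
    LinearMap.range (ρ.fixedPointsMk t (𝓘.K n)) = (ρ.jacquetModule t).fixedPoints ((𝓘.K n).comap t.M.subtype) :=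
  le_antisymm (range_fixedPointsMk_le t (𝓘.K n))
    ((JacquetLemma.fixedPoints_jacquetModule_le_map ρ t 𝓘 hρa n).trans (range_fixedPointsMk t (𝓘.K n)).ge)

/-! ## §4 Fitting: `V^K = ker T_a^N ⊕ im T_a^N`, `[·] : im T_a^N ≅ [V^K]` -/

omit [CharZero k] [IsTopologicalGroup G] in
/-- `V^K` is finite-dimensional for admissible `ρ` and compact open `K`. [cite: BernsteinZelevinsky1976, §2.1] -/
theorem finite_fixedPoints_of_isAdmissible (hρa : ρ.IsAdmissible) {K : Subgroup G} (hK : IsCompact (K : Set G))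
    (hKo : IsOpen (K : Set G)) : Module.Finite k (ρ.fixedPoints K) :=
  hρa.2 ⟨K, hKo⟩ hK

/-- **A Fitting index for `T_a` on `V^K`**: an `N` with `V^K = ker T_a^N ⊕ im T_a^N` and `ker T_a^m ⊆ ker T_a^N` for all `m`
(`V^K` finite-dimensional). [cite: Casselman1995, Prop. 4.1.6] [cite: BernsteinZelevinsky1976, 3.18] -/
theorem exists_fitting_index (hρa : ρ.IsAdmissible) {K : Subgroup G} (hK : IsCompact (K : Set G)) (hKo : IsOpen (K : Set G))
    (a : G) : ∃ N : ℕ,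
      IsCompl (LinearMap.ker ((ρ.heckeRayEnd hK hρa.1 a) ^ N)) (LinearMap.range ((ρ.heckeRayEnd hK hρa.1 a) ^ N)) ∧
      ∀ m : ℕ, LinearMap.ker ((ρ.heckeRayEnd hK hρa.1 a) ^ m) ≤ LinearMap.ker ((ρ.heckeRayEnd hK hρa.1 a) ^ N) := by
  haveI := finite_fixedPoints_of_isAdmissible hρa hK hKo
  set f := ρ.heckeRayEnd hK hρa.1 a
  obtain ⟨N, hN⟩ := Filter.eventually_atTop.mp (f.eventually_isCompl_ker_pow_range_pow.and f.eventually_iSup_ker_pow_eq)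
  refine ⟨N, (hN N le_rfl).1, fun m => ?_⟩
  rw [← (hN N le_rfl).2]
  exact le_iSup (fun m => LinearMap.ker (f ^ m)) m

/-- **`[·]` is injective on `im T_a^N`** (`N` a Fitting index): a vector of `im T_a^N` with class `0` is `T_a`-nilpotent, hence in
`ker T_a^N ∩ im T_a^N = 0`. [cite: Casselman1995, Prop. 4.1.6] [cite: BernsteinZelevinsky1976, 3.18–3.19] -/
theorem fixedPointsMk_injOn_range_pow (t : ParabolicTriple G) {K Nbar : Subgroup G} (hK : IsCompact (K : Set G))
    (hKo : IsOpen (K : Set G)) (hN : IsClosed (t.N : Set G)) (hρa : ρ.IsAdmissible)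
    (hfac : (K : Set G) = ((K ⊓ Nbar : Subgroup G) : Set G) * ((K ⊓ t.M : Subgroup G) : Set G) * ((K ⊓ t.N : Subgroup G) : Set G))
    {a : G} (haMem : a ∈ t.M) (haM : ∀ m ∈ K ⊓ t.M, m * a = a * m) (haN : ∀ n ∈ K ⊓ t.N, a * n * a⁻¹ ∈ K)
    (haNbar : ∀ nb ∈ K ⊓ Nbar, a⁻¹ * nb * a ∈ K ⊓ Nbar)
    (hexh : ∀ n ∈ t.N, ∃ m : ℕ, ∀ m', m ≤ m' → a ^ m' * n * (a ^ m')⁻¹ ∈ K) {N₀ : ℕ}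
    (hc : IsCompl (LinearMap.ker ((ρ.heckeRayEnd hK hρa.1 a) ^ N₀)) (LinearMap.range ((ρ.heckeRayEnd hK hρa.1 a) ^ N₀)))
    (hker : ∀ m : ℕ, LinearMap.ker ((ρ.heckeRayEnd hK hρa.1 a) ^ m) ≤ LinearMap.ker ((ρ.heckeRayEnd hK hρa.1 a) ^ N₀))
    {v : ρ.fixedPoints K} (hv : v ∈ LinearMap.range ((ρ.heckeRayEnd hK hρa.1 a) ^ N₀)) (h0 : ρ.fixedPointsMk t K v = 0) :
    v = 0 := by
  obtain ⟨m, hm⟩ := (fixedPointsMk_eq_zero_iff t hK hKo hN hρa.1 hfac haMem haM haN haNbar hexh v).1 h0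
  have hvker : v ∈ LinearMap.ker ((ρ.heckeRayEnd hK hρa.1 a) ^ N₀) := hker m (LinearMap.mem_ker.2 hm)
  have := hc.disjoint.le_bot (Submodule.mem_inf.2 ⟨hvker, hv⟩)
  simpa using this

/-- **`[im T_a^N] = [V^K]`** (`N` a Fitting index): `V^K = ker T_a^N + im T_a^N` and `[ker T_a^N] = 0`.
[cite: Casselman1995, Prop. 4.1.6] [cite: BernsteinZelevinsky1976, 3.18–3.19] -/
theorem map_fixedPointsMk_range_pow_eq (t : ParabolicTriple G) {K Nbar : Subgroup G} (hK : IsCompact (K : Set G))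
    (hKo : IsOpen (K : Set G)) (hN : IsClosed (t.N : Set G)) (hρa : ρ.IsAdmissible)
    (hfac : (K : Set G) = ((K ⊓ Nbar : Subgroup G) : Set G) * ((K ⊓ t.M : Subgroup G) : Set G) * ((K ⊓ t.N : Subgroup G) : Set G))
    {a : G} (haMem : a ∈ t.M) (haM : ∀ m ∈ K ⊓ t.M, m * a = a * m) (haN : ∀ n ∈ K ⊓ t.N, a * n * a⁻¹ ∈ K)
    (haNbar : ∀ nb ∈ K ⊓ Nbar, a⁻¹ * nb * a ∈ K ⊓ Nbar)
    (hexh : ∀ n ∈ t.N, ∃ m : ℕ, ∀ m', m ≤ m' → a ^ m' * n * (a ^ m')⁻¹ ∈ K) {N₀ : ℕ}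
    (hc : IsCompl (LinearMap.ker ((ρ.heckeRayEnd hK hρa.1 a) ^ N₀)) (LinearMap.range ((ρ.heckeRayEnd hK hρa.1 a) ^ N₀))) :
    (LinearMap.range ((ρ.heckeRayEnd hK hρa.1 a) ^ N₀)).map (ρ.fixedPointsMk t K) = LinearMap.range (ρ.fixedPointsMk t K) := by
  refine le_antisymm LinearMap.map_le_range ?_
  rintro _ ⟨v, rfl⟩
  have hv : v ∈ LinearMap.ker ((ρ.heckeRayEnd hK hρa.1 a) ^ N₀) ⊔ LinearMap.range ((ρ.heckeRayEnd hK hρa.1 a) ^ N₀) := by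
    rw [hc.sup_eq_top]; exact Submodule.mem_top
  obtain ⟨y, hy, z, hz, rfl⟩ := Submodule.mem_sup.1 hv
  have hy0 : ρ.fixedPointsMk t K y = 0 :=
    (fixedPointsMk_eq_zero_iff t hK hKo hN hρa.1 hfac haMem haM haN haNbar hexh y).2 ⟨N₀, LinearMap.mem_ker.1 hy⟩
  exact ⟨z, hz, by rw [map_add, hy0, zero_add]⟩

/-- **Eigenvectors of `π_N(a)` on `[V^K] = V_N^{K ∩ M}` lift to eigenvectors of `T_a` on `V^K`** (admissible `ρ`): for `w = [·]`-image,
`w ≠ 0`, `π_N(a) w = c w`, there is `v ∈ im T_a^N ⊆ V^K`, `v ≠ 0`, with `T_a v = c v` and `[v] = w`.  With ★ `range_fixedPointsMk_eq` (Jacquet's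
lemma) every `K ∩ M`-fixed eigenvector of `π_N(a)` is such a `w`. [cite: Casselman1995, Prop. 4.1.4, Prop. 4.1.6, Thm. 4.4.6] [cite: BernsteinZelevinsky1976, 3.19] -/
theorem exists_heckeRayEnd_eigenvector_of_jacquet (t : ParabolicTriple G) {K Nbar : Subgroup G} (hK : IsCompact (K : Set G))
    (hKo : IsOpen (K : Set G)) (hN : IsClosed (t.N : Set G)) (hρa : ρ.IsAdmissible)
    (hfac : (K : Set G) = ((K ⊓ Nbar : Subgroup G) : Set G) * ((K ⊓ t.M : Subgroup G) : Set G) * ((K ⊓ t.N : Subgroup G) : Set G))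
    {a : G} (haMem : a ∈ t.M) (haM : ∀ m ∈ K ⊓ t.M, m * a = a * m) (haN : ∀ n ∈ K ⊓ t.N, a * n * a⁻¹ ∈ K)
    (haNbar : ∀ nb ∈ K ⊓ Nbar, a⁻¹ * nb * a ∈ K ⊓ Nbar)
    (hexh : ∀ n ∈ t.N, ∃ m : ℕ, ∀ m', m ≤ m' → a ^ m' * n * (a ^ m')⁻¹ ∈ K)
    {w : (t.restrict ρ).Coinvariants} (hw : w ∈ LinearMap.range (ρ.fixedPointsMk t K)) (hw0 : w ≠ 0) {c : k}
    (hcw : ρ.jacquetModule t ⟨a, haMem⟩ w = c • w) :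
    ∃ v : ρ.fixedPoints K, v ≠ 0 ∧ ρ.heckeRayEnd hK hρa.1 a v = c • v ∧ ρ.fixedPointsMk t K v = w := by
  obtain ⟨N₀, hc, hker⟩ := exists_fitting_index hρa hK hKo a
  set T := ρ.heckeRayEnd hK hρa.1 a with hT
  rw [← map_fixedPointsMk_range_pow_eq t hK hKo hN hρa hfac haMem haM haN haNbar hexh hc] at hw
  obtain ⟨z, hz, rfl⟩ := hw
  -- `T z ∈ im T^N₀`
  have hTz : T z ∈ LinearMap.range (T ^ N₀) := by
    obtain ⟨y, rfl⟩ := hz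
    exact ⟨T y, by rw [← Module.End.mul_apply, ← pow_succ, pow_succ', Module.End.mul_apply]⟩
  -- `[T z - c z] = 0`
  have hcl : ρ.fixedPointsMk t K (T z - c • z) = 0 := by
    rw [map_sub, map_smul, fixedPointsMk_apply, hT, heckeRayEnd_apply_coe,
      mk_heckeRay t hK hN hρa.1 hfac haMem haM (fun nb hnb => (Subgroup.mem_inf.1 (haNbar nb hnb)).1) z.2,
      ← fixedPointsMk_apply, hcw, sub_self]
  have hzero := fixedPointsMk_injOn_range_pow t hK hKo hN hρa hfac haMem haM haN haNbar hexh hc hker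
    (Submodule.sub_mem _ hTz (Submodule.smul_mem _ c hz)) hcl
  refine ⟨z, fun h => hw0 (by rw [h, map_zero]), (sub_eq_zero.1 hzero), rfl⟩

end Fitting

end Representation
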